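import Mathlib
import Summits.PneNP.PneNP.Theorems.OverlapGapAlgebraSolvableImpliesStableSectionMonotoneRepairWalkExtract
import Summits.PneNP.PneNP.Theorems.OverlapGapAlgebraSolvableImpliesStableSectionTwoWayRepairTreeWalks
import Summits.PneNP.PneNP.Theorems.OverlapGapAlgebraSolvableImpliesStableSectionTwoWayRepairWalkOps

/-!
# PneNP / OverlapGapAlgebra — crux `SolvableImpliesStableSection` (stmt-PneNP-2463):
# the TWO-WAY REPAIR block (10/·) — a witness tree is injective or exhibits a bad walk

Support for crux `stmt-PneNP-2463` (`Summit.PneNP.PneNP.Theses.OverlapGapAlgebra.SolvableImpliesStableSection`):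
the f-free block "bounded-round two-way repair with one-round memory gives stable sections for every
`ν > 0` up to `α ≤ 2^k/(4k)`".  The dichotomy behind the first moment, for the TWO-WAY witness trees:
either the nodes of a syntactically valid tree code carry pairwise distinct clauses (the code is
injective, counted exactly by `sissW_treeCount`), or two nodes share a clause and the code contains a
BAD WALK from the root clause (`…MonotoneRepairBadCount`).  New feature: the least childless slot is a
property of the NODE, so two nodes with the same clause `x` may flip different slots `jn₁ ≠ jn₂`; then
the bad walk is routed THROUGH `x` (entered at `jn₁`, left at `jn₂`) instead of across it.

* `sissW_badWalk_of_rootRepeat` — a non-root node carrying the root clause gives a bad walk;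
* `sissW_injOrBad` — a non-injective valid code of depth `≤ D` has a bad walk of length `≤ 2D` from
  its root clause.
No definitions (all objects are hypotheses); axioms `propext`, `Classical.choice`, `Quot.sound`.
-/

set_option linter.dupNamespace false -- `Summit.PneNP.PneNP.…`: summit = sub-problem (D-0017)

namespace Summit.PneNP.PneNP.Theorems

open Finset
open scoped Classical

section InjOrBad

variable {m k n : ℕ}

/-- **A non-root node carrying the root clause gives a bad walk** (walk up to the root: a closed
clause-walk of length `|b| ≥ 1`). -/
theorem sissW_badWalk_of_rootRepeat (T : Finset (List (Fin k) × (Fin m × ℕ))) (Φ : (Fin m → Fin k → Fin n × Bool))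
    (hfun : ∀ (a : List (Fin k)) (lab lab' : Fin m × ℕ), (a, lab) ∈ T → (a, lab') ∈ T → lab = lab')
    (hpar : ∀ (j : Fin k) (a : List (Fin k)) (lab : Fin m × ℕ), (j :: a, lab) ∈ T →
      ∃ lab' : Fin m × ℕ, (a, lab') ∈ T)
    (hsyn : ∀ e ∈ T, ∀ j : Fin k,
      (((Φ e.2.1 j).2 = true ↔ ((∃ (y : Fin m) (s : ℕ), (j :: e.1, (y, s)) ∈ T ∧ s % 2 = 0) ∨
        ((∀ lab : Fin m × ℕ, (j :: e.1, lab) ∉ T) ∧ e.2.2 % 2 = 1))) ∧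
      ∀ (y : Fin m) (s : ℕ), (j :: e.1, (y, s)) ∈ T → ∃ j' : Fin k,
        (∀ lab : Fin m × ℕ, (j' :: j :: e.1, lab) ∉ T) ∧
        (∀ j'' : Fin k, j'' < j' → ∃ lab : Fin m × ℕ, (j'' :: j :: e.1, lab) ∈ T) ∧
        (Φ e.2.1 j).1 = (Φ y j').1))
    (c : Fin m) (rc : ℕ) (hroot : (([] : List (Fin k)), (c, rc)) ∈ T) (j₀ : Fin k)
    (b : List (Fin k)) (r : ℕ) (hb : (b, (c, r)) ∈ T) (hbne : b ≠ []) :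
    ∃ L : ℕ, L ≤ b.length ∧ (∃ (w : ℕ → Fin m) (u o : ℕ → Fin k) (a : ℕ) (j : Fin k),
        w 0 = c ∧ a ≤ L ∧ (∀ a' b', a' ≤ L → b' ≤ L → w a' = w b' → a' = b') ∧
        (∀ d, d < L → (Φ (w (d + 1)) (u (d + 1))).1 = (Φ (w d) (o d)).1) ∧
        (L = 0 ∨ o L ≠ u L) ∧ (a < L ∨ j ≠ o L) ∧ (Φ (w L) (o L)).1 = (Φ (w a) j).1) := by
  obtain ⟨w, u, o, hw0, hwlen, hsteps, hio, hsep, _, _⟩ :=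
    sissW_upWalk T Φ hfun hpar hsyn c rc hroot j₀ b c r hb
  have hlen : 1 ≤ b.length := by
    cases b with
    | nil => exact absurd rfl hbne
    | cons _ _ => simp
  obtain ⟨L, hL, hbad⟩ := sissR_walk_closed Φ b.length hlen w u o hsteps
    (fun i h1 h2 => hio i h1 (by omega)) hsep (by rw [hwlen, hw0])
  rw [hw0] at hbad
  exact ⟨L, by omega, hbad⟩

/-- **A non-injective two-way witness tree yields a bad walk.** Let the tree code `T` be functional,
parent-closed, of depth `≤ D`, syntactically valid in `Φ` (two-way rule), with root clause `c`. If two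
distinct nodes of `T` carry the same clause, then a bad walk of some length `L ≤ 2D` starts at `c`. -/
theorem sissW_injOrBad (T : Finset (List (Fin k) × (Fin m × ℕ))) (Φ : (Fin m → Fin k → Fin n × Bool))
    (hfun : ∀ (a : List (Fin k)) (lab lab' : Fin m × ℕ), (a, lab) ∈ T → (a, lab') ∈ T → lab = lab')
    (hpar : ∀ (j : Fin k) (a : List (Fin k)) (lab : Fin m × ℕ), (j :: a, lab) ∈ T →
      ∃ lab' : Fin m × ℕ, (a, lab') ∈ T)
    (hsyn : ∀ e ∈ T, ∀ j : Fin k,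
      (((Φ e.2.1 j).2 = true ↔ ((∃ (y : Fin m) (s : ℕ), (j :: e.1, (y, s)) ∈ T ∧ s % 2 = 0) ∨
        ((∀ lab : Fin m × ℕ, (j :: e.1, lab) ∉ T) ∧ e.2.2 % 2 = 1))) ∧
      ∀ (y : Fin m) (s : ℕ), (j :: e.1, (y, s)) ∈ T → ∃ j' : Fin k,
        (∀ lab : Fin m × ℕ, (j' :: j :: e.1, lab) ∉ T) ∧
        (∀ j'' : Fin k, j'' < j' → ∃ lab : Fin m × ℕ, (j'' :: j :: e.1, lab) ∈ T) ∧
        (Φ e.2.1 j).1 = (Φ y j').1))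
    (c : Fin m) (rc : ℕ) (hroot : (([] : List (Fin k)), (c, rc)) ∈ T) (j₀ : Fin k)
    (D : ℕ) (hlen : ∀ e ∈ T, e.1.length ≤ D)
    (hninj : ¬ ∀ e ∈ T, ∀ e' ∈ T, e.2.1 = e'.2.1 → e.1 = e'.1) :
    ∃ L : ℕ, L ≤ 2 * D ∧ (∃ (w : ℕ → Fin m) (u o : ℕ → Fin k) (a : ℕ) (j : Fin k),
        w 0 = c ∧ a ≤ L ∧ (∀ a' b', a' ≤ L → b' ≤ L → w a' = w b' → a' = b') ∧
        (∀ d, d < L → (Φ (w (d + 1)) (u (d + 1))).1 = (Φ (w d) (o d)).1) ∧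
        (L = 0 ∨ o L ≠ u L) ∧ (a < L ∨ j ≠ o L) ∧ (Φ (w L) (o L)).1 = (Φ (w a) j).1) := by
  -- the reversed walk from the root down to the parent node `(p, (y, s))` of a child at slot `j`
  have hdown : ∀ (p : List (Fin k)) (y : Fin m) (s : ℕ), (p, (y, s)) ∈ T →
      ∀ (j : Fin k) (lab : Fin m × ℕ), (j :: p, lab) ∈ T →
      ∃ (W : ℕ → Fin m) (U O : ℕ → Fin k), W 0 = c ∧ W p.length = y ∧ O p.length = j ∧
        (∀ d, d < p.length → (Φ (W (d + 1)) (U (d + 1))).1 = (Φ (W d) (O d)).1) ∧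
        (∀ i, 1 ≤ i → i ≤ p.length → U i ≠ O i) ∧
        (∀ d, d < p.length → W (d + 1) = W d → U (d + 1) ≠ O d) := by
    intro p y s hp j lab hjlab
    obtain ⟨w, u, o, hw0, hwlen, hsteps, hio, hsep, hless, _⟩ :=
      sissW_upWalk T Φ hfun hpar hsyn c rc hroot j₀ p y s hp
    obtain ⟨W, U, O, hW0, hWP, hOP, hWsteps, hWio, hWsep⟩ :=
      sissW_walk_rev Φ p.length w u o hsteps hio hsep j (fun h1 hcon => by
        have hne : p ≠ [] := by intro h; subst h; simp at h1
        exact hless hne lab (by rw [← hcon]; exact hjlab))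
    exact ⟨W, U, O, by rw [hW0, hwlen], by rw [hWP, hw0], hOP, hWsteps, hWio, hWsep⟩
  -- the claim, by strong induction on the sum of the depths of the two nodes
  have main : ∀ N : ℕ, ∀ (b₁ b₂ : List (Fin k)) (x₁ x₂ : Fin m) (r₁ r₂ : ℕ),
      (b₁, (x₁, r₁)) ∈ T → (b₂, (x₂, r₂)) ∈ T → x₁ = x₂ → b₁ ≠ b₂ → b₁.length + b₂.length = N →
      ∃ L : ℕ, L ≤ b₁.length + b₂.length ∧ (∃ (w : ℕ → Fin m) (u o : ℕ → Fin k) (a : ℕ) (j : Fin k),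
        w 0 = c ∧ a ≤ L ∧ (∀ a' b', a' ≤ L → b' ≤ L → w a' = w b' → a' = b') ∧
        (∀ d, d < L → (Φ (w (d + 1)) (u (d + 1))).1 = (Φ (w d) (o d)).1) ∧
        (L = 0 ∨ o L ≠ u L) ∧ (a < L ∨ j ≠ o L) ∧ (Φ (w L) (o L)).1 = (Φ (w a) j).1) := by
    intro N
    induction N using Nat.strong_induction_on with
    | _ N ih =>
      intro b₁ b₂ x₁ x₂ r₁ r₂ hb₁ hb₂ hxx hbb hN
      subst hxx
      cases b₁ with
      | nil =>
        cases b₂ with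
        | nil => exact absurd rfl hbb
        | cons j₂ p₂ =>
          have hxc : x₁ = c := (Prod.mk.inj (hfun [] (x₁, r₁) (c, rc) hb₁ hroot)).1
          subst hxc
          obtain ⟨L, hL, hbad⟩ := sissW_badWalk_of_rootRepeat T Φ hfun hpar hsyn x₁ rc hroot j₀
            (j₂ :: p₂) r₂ hb₂ (List.cons_ne_nil _ _)
          exact ⟨L, by simp at hL ⊢; omega, hbad⟩
      | cons j₁ p₁ =>
        cases b₂ with
        | nil =>
          have hxc : x₁ = c := (Prod.mk.inj (hfun [] (x₁, r₂) (c, rc) hb₂ hroot)).1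
          subst hxc
          obtain ⟨L, hL, hbad⟩ := sissW_badWalk_of_rootRepeat T Φ hfun hpar hsyn x₁ rc hroot j₀
            (j₁ :: p₁) r₁ hb₁ (List.cons_ne_nil _ _)
          exact ⟨L, by simp at hL ⊢; omega, hbad⟩
        | cons j₂ p₂ =>
          -- both nodes have parents
          obtain ⟨⟨y₁, s₁⟩, hp₁⟩ := hpar j₁ p₁ (x₁, r₁) hb₁
          obtain ⟨⟨y₂, s₂⟩, hp₂⟩ := hpar j₂ p₂ (x₁, r₂) hb₂
          obtain ⟨jn₁, _, _, heq₁, hsx₁, hsy₁⟩ := sissW_edge_facts T Φ hfun hsyn p₁ y₁ s₁ hp₁ j₁ x₁ r₁ hb₁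
          obtain ⟨jn₂, _, _, heq₂, hsx₂, hsy₂⟩ := sissW_edge_facts T Φ hfun hsyn p₂ y₂ s₂ hp₂ j₂ x₁ r₂ hb₂
          -- alternation along the two edges: equal clauses force different slots
          have halt₁ : x₁ = y₁ → jn₁ ≠ j₁ := by
            intro hxy hjj
            rw [← hxy, ← hjj] at hsx₁
            rw [hsx₁] at hsy₁
            omega
          have halt₂ : y₂ = x₁ → j₂ ≠ jn₂ := by
            intro hxy hjj
            rw [hxy, hjj] at hsx₂
            rw [hsx₂] at hsy₂
            omega
          -- the walk down to the first parent
          obtain ⟨W, U, O, hW0, hWP, hOP, hWsteps, hWio, hWsep⟩ := hdown p₁ y₁ s₁ hp₁ j₁ (x₁, r₁) hb₁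
          by_cases hp : p₁ = p₂
          · -- siblings
            subst hp
            have hyy : y₁ = y₂ := (Prod.mk.inj (hfun p₁ (y₁, s₁) (y₂, s₂) hp₁ hp₂)).1
            subst hyy
            have hjj : j₁ ≠ j₂ := fun h => hbb (by rw [h])
            by_cases hjn : jn₁ = jn₂
            · -- same flipped slot: close at the common parent with the two slots
              subst hjn
              have KEY : (Φ y₁ j₁).1 = (Φ y₁ j₂).1 := by rw [heq₁, heq₂]
              obtain ⟨L, hL, hbad⟩ := sissR_walk_extract Φ p₁.length W U O hWsteps hWio hWsep
                p₁.length j₂ (Or.inr ⟨rfl, by rw [hOP]; exact hjj.symm⟩) (by rw [hOP, hWP]; exact KEY)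
              rw [hW0] at hbad
              exact ⟨L, by simp; omega, hbad⟩
            · -- different flipped slots: through the repeated clause
              obtain ⟨W', U', O', hW'i, hW'P, hO'P, _, hW'steps, hW'io, hW'sep⟩ :=
                sissW_walk_append Φ p₁.length W U O hWsteps hWio hWsep x₁ jn₁ jn₂
                  (by rw [hOP, hWP]; exact heq₁.symm) hjn (by rw [hWP, hOP]; exact halt₁)
              obtain ⟨L, hL, hbad⟩ := sissR_walk_extract Φ (p₁.length + 1) W' U' O' hW'steps hW'io hW'sep
                p₁.length j₂ (Or.inl (Nat.lt_succ_self _))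
                (by rw [hO'P, hW'P, hW'i p₁.length le_rfl, hWP]; exact heq₂.symm)
              rw [hW'i 0 (Nat.zero_le _), hW0] at hbad
              exact ⟨L, by simp; omega, hbad⟩
          · by_cases hy : y₁ = y₂
            · -- the parents carry the same clause: induction
              obtain ⟨L, hL, hbad⟩ := ih (p₁.length + p₂.length) (by rw [← hN]; simp; omega)
                p₁ p₂ y₁ y₂ s₁ s₂ hp₁ hp₂ hy hp rfl
              exact ⟨L, by simp; omega, hbad⟩
            · -- down to the first parent, (through `x`,) across to the second, up to the root
              obtain ⟨w₂, u₂, o₂, hw₂0, hw₂len, hsteps₂, hio₂, hsep₂, hless₂, _⟩ :=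
                sissW_upWalk T Φ hfun hpar hsyn c rc hroot j₀ p₂ y₂ s₂ hp₂
              have hj₂o : 1 ≤ p₂.length → j₂ ≠ o₂ 0 := by
                intro h1 hcon
                have hne : p₂ ≠ [] := by intro h; subst h; simp at h1
                exact hless₂ hne (x₁, r₂) (by rw [← hcon]; exact hb₂)
              by_cases hjn : jn₁ = jn₂
              · subst hjn
                obtain ⟨Wc, Uc, Oc, hWc0, hWcM, hWcsteps, hWcio, hWcsep⟩ :=
                  sissW_walk_concat Φ p₁.length W U O hWsteps hWio hWsep p₂.length w₂ u₂ o₂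
                    hsteps₂ hio₂ hsep₂ j₂ (by rw [hw₂0, hWP, hOP, heq₂, heq₁]) hj₂o
                    (by rw [hw₂0, hWP]; intro h; exact absurd h.symm hy)
                obtain ⟨L, hL, hbad⟩ := sissR_walk_closed Φ (p₁.length + 1 + p₂.length) (by omega)
                  Wc Uc Oc hWcsteps (fun i h1 h2 => hWcio i h1 (by omega)) hWcsep
                  (by rw [hWcM, hw₂len, hWc0, hW0])
                rw [hWc0, hW0] at hbad
                exact ⟨L, by simp; omega, hbad⟩
              · obtain ⟨W', U', O', hW'i, hW'P, hO'P, _, hW'steps, hW'io, hW'sep⟩ :=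
                  sissW_walk_append Φ p₁.length W U O hWsteps hWio hWsep x₁ jn₁ jn₂
                    (by rw [hOP, hWP]; exact heq₁.symm) hjn (by rw [hWP, hOP]; exact halt₁)
                obtain ⟨Wc, Uc, Oc, hWc0, hWcM, hWcsteps, hWcio, hWcsep⟩ :=
                  sissW_walk_concat Φ (p₁.length + 1) W' U' O' hW'steps hW'io hW'sep p₂.length w₂ u₂ o₂
                    hsteps₂ hio₂ hsep₂ j₂ (by rw [hw₂0, hW'P, hO'P, heq₂]) hj₂o
                    (by rw [hw₂0, hW'P, hO'P]; exact halt₂)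
                obtain ⟨L, hL, hbad⟩ := sissR_walk_closed Φ (p₁.length + 1 + 1 + p₂.length) (by omega)
                  Wc Uc Oc hWcsteps (fun i h1 h2 => hWcio i h1 (by omega)) hWcsep
                  (by rw [hWcM, hw₂len, hWc0, hW'i 0 (Nat.zero_le _), hW0])
                rw [hWc0, hW'i 0 (Nat.zero_le _), hW0] at hbad
                exact ⟨L, by simp; omega, hbad⟩
  -- two distinct nodes with the same clause
  simp only [not_forall, exists_prop] at hninj
  obtain ⟨e, he, e', he', hxx, hne⟩ := hninj
  obtain ⟨L, hL, hbad⟩ := main _ e.1 e'.1 e.2.1 e'.2.1 e.2.2 e'.2.2 (by simpa using he)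
    (by simpa using he') hxx hne rfl
  exact ⟨L, by have h1 := hlen e he; have h2 := hlen e' he'; omega, hbad⟩

end InjOrBad

end Summit.PneNP.PneNP.Theorems
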